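import Summits.CriticalPhenomena.PercolationContinuityZ3.Theorems.PercAnnulusCrossingNoiseStability
import HarnessLib

/-!
# RSW3 lane (lead, gen 21): THE SPECTRAL SAMPLE OF A CROSSING, I — resampling a fixed set of coordinates, influences,
# and TOTAL INFLUENCE = MEAN SIZE OF THE SPECTRAL SAMPLE (abstract p-biased cube, degenerate coordinates allowed)

builds on p205010 (kernel theorem, internal audit signed; external expert review pending) — NOT used in this file (abstract).

Cell `prim-rsw3` (LANE 3), lead seat, gen 21.  Support file (`--supports stmt-CriticalPhenomena-4575`); no definitions, no named facts,
no sorries.  Setting of gen 20's parts I–IV (`…NoiseFourier`, `…NoiseStability`): finite product cube `ι → Bool` with biases `p ∈ [0,1]^ι`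
and product weight `wt p`, a character system `r` satisfying (H1)/(H2), Walsh characters `χ_S(x) = Π_{i∈S} r_i(x_i)` and coefficients
`f̂(S) = Σ_x wt(x) f(x) χ_S(x)` (written out).  RESAMPLING THE COORDINATES OF A FIXED SET `A` of `x ~ wt p` from an independent copy
`y ~ wt p` gives `E_A f (x) = Σ_y wt(y) f(y on A, x off A)` (O'Donnell's `E_A`; for `A = {i}`, `E_i f(x) = Σ_y wt(y) f(x^{i→y_i})`), and
`f − E_A f` is "the part of `f` that reads `A`" (the coordinate Laplacian `L_i f = f − E_i f` for `A = {i}`).  Proved, every `p ∈ [0,1]^ι`: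

* §1 `sum_wt_char_resample` — `E_y[χ_S(y on A, x off A)] = 𝟙[S ∩ A = ∅]·χ_S(x)` (H1); **`resample_coeff`** — RESAMPLING IS DIAGONAL:
  `(E_A f)^(S) = 𝟙[S ∩ A = ∅]·f̂(S)`; **`sum_wt_sub_resample_sq`** — `E[(f − E_A f)²] = Σ_{S ∩ A ≠ ∅} f̂(S)²` (Parseval, part I).
* §2 THE INFLUENCE OF A COORDINATE, three ways: **`influence_eq_sum_coeff_sq`** — `E[(f − E_i f)²] = Σ_{S ∋ i} f̂(S)²` (spectral);
  **`influence_eq_bias_mul_sum_sq`** — `E[(f − E_i f)²] = p_i(1−p_i)·E[(f(x^{i→1}) − f(x^{i→0}))²]` (pivotal form; no characters; for a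
  0/1-valued monotone `f` the last expectation is `P(i pivotal)`).
* §3 **`sum_influence_eq_sum_card_mul_coeff_sq`** — TOTAL INFLUENCE = MEAN SIZE OF THE SPECTRAL SAMPLE:
  `Σ_i E[(f − E_i f)²] = Σ_S |S|·f̂(S)²` (O'Donnell Thm 2.38 / Prop 8.23; Garban–Steif's `E_{𝒬_f}|𝒮| = I(f)`), also in the pivotal currency
  `Σ_i p_i(1−p_i) E[(D_i f)²] = Σ_S |S| f̂(S)²`; **`mul_high_level_weight_le`** — MARKOV ON THE SPECTRAL SAMPLE:
  `M·Σ_{|S| ≥ M} f̂(S)² ≤ Σ_S |S| f̂(S)²` (O'Donnell Prop 3.2: the spectrum is `I/M`-concentrated below level `M`).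

With gen 20 (`level_weight_le_revealment`: almost no weight at levels `≤ m` when the revealment is small) this brackets the spectral sample of a
crossing between `δ^{-1/2}` and its pivotal count (parts II–V of this generation).

References: R. O'Donnell, *Analysis of Boolean Functions*, CUP 2014, §2.3 Thm 2.38, §3.1 Prop 3.2, §8.3 Def 8.22 / Prop 8.23 / Prop 8.24,
§8.4 Def 8.44 / Prop 8.45; C. Garban, J. Steif, *Noise sensitivity of Boolean functions and percolation*, CUP 2014, Ch. I Def I.4–I.6
(influences), Ch. IX Def IX.1–IX.2 (the spectral sample); C. Garban, G. Pete, O. Schramm, Acta Math. 205 (2010) §1 (the spectral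
sample of percolation crossings and the pivotal set).
-/

noncomputable section

namespace Summit.CriticalPhenomena.PercolationContinuityZ3.Theorems.Crossing.Spectral

open Finset Function
open Literature.Probability.ODonnellSaksSchrammServedio2005

variable {ι : Type*} [Fintype ι] [DecidableEq ι]

/-! ## §1 Resampling a fixed set of coordinates is diagonal -/

/-- **`E_y[χ_S(y on A, x off A)] = Π_{i∈S} 𝟙[i ∉ A]·r_i(x_i)`**: a resampled coordinate of `S` contributes the mean-zero factor `E[r_i] = 0`
(H1). [cite: ODonnell2014, §8.3 Prop 8.23 (E_i φ_S = 𝟙[i ∉ S] φ_S, via Cor 8.21)] -/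
theorem sum_wt_char_resample {p : ι → ℝ} {r : ι → Bool → ℝ} (hH1 : ∀ i, p i * r i true + (1 - p i) * r i false = 0)
    (S A : Finset ι) (x : ι → Bool) :
    ∑ y : ι → Bool, wt p y * ∏ i ∈ S, r i (if i ∈ A then y i else x i)
      = ∏ i ∈ S, (if i ∈ A then 0 else r i (x i)) := by
  rw [sum_wt_mul_prod_finset p S (fun i b => r i (if i ∈ A then b else x i))]
  refine Finset.prod_congr rfl fun i _ => ?_
  by_cases hi : i ∈ A
  · simp only [if_pos hi]; exact hH1 i
  · simp only [if_neg hi]; ring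

/-- **RESAMPLING A FIXED SET IS DIAGONAL**: the `S`-coefficient of `E_A f (x) = Σ_y wt(y)·f(y on A, x off A)` is `𝟙[S ∩ A = ∅]·f̂(S)`
(exchange the `A`-coordinates of the two independent samples, part IV `sum_sum_wt_mix_swap`, then `sum_wt_char_resample`).
[cite: ODonnell2014, §8.3 Prop 8.23 (E_i f = Σ_{S ∌ i} f̂(S) φ_S; L_i f = Σ_{S ∋ i} f̂(S) φ_S)] -/
theorem resample_coeff {p : ι → ℝ} {r : ι → Bool → ℝ} (hH1 : ∀ i, p i * r i true + (1 - p i) * r i false = 0)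
    (f : (ι → Bool) → ℝ) (A S : Finset ι) :
    ∑ x : ι → Bool, wt p x * ((∑ y : ι → Bool, wt p y * f (fun i => if i ∈ A then y i else x i)) * ∏ i ∈ S, r i (x i))
      = (if Disjoint S A then 1 else 0) * ∑ x : ι → Bool, wt p x * (f x * ∏ i ∈ S, r i (x i)) := by
  calc ∑ x : ι → Bool, wt p x * ((∑ y : ι → Bool, wt p y * f (fun i => if i ∈ A then y i else x i)) * ∏ i ∈ S, r i (x i))
      = ∑ x : ι → Bool, ∑ y : ι → Bool, wt p x * wt p y *
          (f (fun i => if i ∈ A then y i else x i) * ∏ i ∈ S, r i (x i)) := by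
        refine Finset.sum_congr rfl fun x _ => ?_
        rw [Finset.sum_mul, Finset.mul_sum]
        exact Finset.sum_congr rfl fun y _ => by ring
    _ = ∑ x : ι → Bool, ∑ y : ι → Bool, wt p x * wt p y * (f x * ∏ i ∈ S, r i (if i ∈ A then y i else x i)) := by
        rw [sum_sum_wt_mix_swap p A]
        refine Finset.sum_congr rfl fun x _ => Finset.sum_congr rfl fun y _ => ?_
        congr 2
        · congr 1; funext i; by_cases hi : i ∈ A <;> simp [hi]
    _ = ∑ x : ι → Bool, wt p x * (f x * ∑ y : ι → Bool, wt p y * ∏ i ∈ S, r i (if i ∈ A then y i else x i)) := by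
        refine Finset.sum_congr rfl fun x _ => ?_
        simp only [Finset.mul_sum]
        exact Finset.sum_congr rfl fun y _ => by ring
    _ = ∑ x : ι → Bool, wt p x * (f x * ∏ i ∈ S, (if i ∈ A then 0 else r i (x i))) := by
        refine Finset.sum_congr rfl fun x _ => ?_
        rw [sum_wt_char_resample hH1 S A x]
    _ = (if Disjoint S A then 1 else 0) * ∑ x : ι → Bool, wt p x * (f x * ∏ i ∈ S, r i (x i)) := by
        split_ifs with hSA
        · rw [one_mul]
          refine Finset.sum_congr rfl fun x _ => ?_
          congr 2
          exact Finset.prod_congr rfl fun i hi => if_neg (Finset.disjoint_left.1 hSA hi)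
        · rw [zero_mul]
          obtain ⟨i, hiS, hiA⟩ := Finset.not_disjoint_iff.1 hSA
          refine Finset.sum_eq_zero fun x _ => ?_
          rw [Finset.prod_eq_zero hiS (by rw [if_pos hiA] : (if i ∈ A then (0 : ℝ) else r i (x i)) = 0)]
          ring

section WithH2

variable {p : ι → ℝ} {r : ι → Bool → ℝ}
  (hH1 : ∀ i, p i * r i true + (1 - p i) * r i false = 0)
  (hH2 : ∀ i (b b' : Bool), coordWt p i b ≠ 0 → coordWt p i b' * (1 + r i b * r i b') = if b' = b then 1 else 0)

include hH1 hH2 in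
/-- **`E[(f − E_A f)²] = Σ_{S ∩ A ≠ ∅} f̂(S)²`**: the part of `f` that reads the coordinates of `A` carries exactly the Fourier weight of the
sets meeting `A` (Parseval of part I for `f − E_A f`, whose coefficients are `𝟙[S ∩ A ≠ ∅]·f̂(S)` by `resample_coeff`).
[cite: ODonnell2014, §8.3 Def 8.22 / Prop 8.23 (Inf_i[f] = ⟨L_i f, L_i f⟩ = Σ_{S ∋ i} f̂(S)², by Plancherel)] -/
theorem sum_wt_sub_resample_sq (f : (ι → Bool) → ℝ) (A : Finset ι) :
    ∑ x : ι → Bool, wt p x * (f x - ∑ y : ι → Bool, wt p y * f (fun i => if i ∈ A then y i else x i)) ^ 2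
      = ∑ S ∈ (Finset.univ : Finset ι).powerset.filter (fun S => ¬ Disjoint S A),
          (∑ x : ι → Bool, wt p x * (f x * ∏ i ∈ S, r i (x i))) ^ 2 := by
  -- the function `g = f − E_A f` and its coefficients
  obtain ⟨g, hg⟩ : ∃ g : (ι → Bool) → ℝ, g = fun x => f x - ∑ y : ι → Bool, wt p y * f (fun i => if i ∈ A then y i else x i) :=
    ⟨_, rfl⟩
  have hcoeff : ∀ S : Finset ι, ∑ x : ι → Bool, wt p x * (g x * ∏ i ∈ S, r i (x i))
      = (if Disjoint S A then 0 else 1) * ∑ x : ι → Bool, wt p x * (f x * ∏ i ∈ S, r i (x i)) := by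
    intro S
    have hsplit : ∀ x : ι → Bool, wt p x * (g x * ∏ i ∈ S, r i (x i))
        = wt p x * (f x * ∏ i ∈ S, r i (x i))
          - wt p x * ((∑ y : ι → Bool, wt p y * f (fun i => if i ∈ A then y i else x i)) * ∏ i ∈ S, r i (x i)) := by
      intro x; rw [hg]; ring
    rw [Finset.sum_congr rfl (fun x _ => hsplit x), Finset.sum_sub_distrib, resample_coeff hH1 f A S]
    split_ifs <;> ring
  have hlhs : ∑ x : ι → Bool, wt p x * (f x - ∑ y : ι → Bool, wt p y * f (fun i => if i ∈ A then y i else x i)) ^ 2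
      = ∑ x : ι → Bool, wt p x * (g x * g x) := by
    refine Finset.sum_congr rfl fun x _ => ?_
    rw [hg]; ring
  rw [hlhs, sum_wt_mul_sq_eq_sum_coeff_sq hH2 g, Finset.sum_filter]
  refine Finset.sum_congr rfl fun S _ => ?_
  rw [hcoeff S]
  split_ifs <;> ring

/-! ## §2 The influence of one coordinate -/

omit [Fintype ι] in
/-- `(y on {i}, x off {i}) = x^{i → y_i}`. [folklore] -/
theorem resample_singleton_eq_update (i : ι) (x y : ι → Bool) :
    (fun j => if j ∈ ({i} : Finset ι) then y j else x j) = update x i (y i) := by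
  funext j
  by_cases hj : j = i
  · subst hj; simp
  · simp [Finset.mem_singleton, hj]

include hH1 hH2 in
/-- **THE INFLUENCE OF A COORDINATE, SPECTRALLY**: `E[(f − E_i f)²] = Σ_{S ∋ i} f̂(S)²` with `E_i f(x) = Σ_y wt(y) f(x^{i→y_i})`
(O'Donnell's `Inf_i[f] = ‖L_i f‖²`; for every `p ∈ [0,1]^ι`, degenerate coordinates included).
[cite: ODonnell2014, §8.3 Def 8.22 and Prop 8.23 (Inf_i[f] = Σ_{S ∋ i} f̂(S)²)] [cite: GarbanSteif2014, Ch. IX Def IX.1 (the spectral measure f̂(S)²)] -/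
theorem influence_eq_sum_coeff_sq (f : (ι → Bool) → ℝ) (i : ι) :
    ∑ x : ι → Bool, wt p x * (f x - ∑ y : ι → Bool, wt p y * f (update x i (y i))) ^ 2
      = ∑ S ∈ (Finset.univ : Finset ι).powerset.filter (fun S => i ∈ S),
          (∑ x : ι → Bool, wt p x * (f x * ∏ j ∈ S, r j (x j))) ^ 2 := by
  have h := sum_wt_sub_resample_sq hH1 hH2 f {i}
  simp only [resample_singleton_eq_update] at h
  rw [h]
  refine Finset.sum_congr ?_ fun S _ => rfl
  ext S
  simp only [Finset.mem_filter, Finset.disjoint_singleton_right, not_not]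

omit [DecidableEq ι] in
/-- `E_i f (x) = p_i·f(x^{i→1}) + (1 − p_i)·f(x^{i→0})` (integrating out the resampled coordinate).
[cite: ODonnell2014, §8.3 (the averaging operator E_i)] -/
theorem sum_wt_update_eq [DecidableEq ι] (p : ι → ℝ) (f : (ι → Bool) → ℝ) (i : ι) (x : ι → Bool) :
    ∑ y : ι → Bool, wt p y * f (update x i (y i)) = p i * f (update x i true) + (1 - p i) * f (update x i false) := by
  have h2 : ∀ y : ι → Bool, wt p y * f (update x i (y i))
      = wt p y * (if y i = true then f (update x i true) else f (update x i false)) := by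
    intro y; rcases Bool.eq_false_or_eq_true (y i) with hy | hy <;> simp [hy]
  rw [Finset.sum_congr rfl (fun y _ => h2 y),
    sum_wt_ite p i (fun _ => f (update x i true)) (fun _ => f (update x i false)) (fun _ _ => rfl) (fun _ _ => rfl)]
  have hc : ∀ c : ℝ, ∑ y : ι → Bool, wt p y * c = c := by
    intro c; rw [← Finset.sum_mul, sum_wt, one_mul]
  rw [hc, hc]

/-- **THE INFLUENCE OF A COORDINATE, IN THE PIVOTAL CURRENCY** (no characters, every `p`):
`E[(f − E_i f)²] = p_i(1−p_i)·E[(f(x^{i→1}) − f(x^{i→0}))²]` — `f − E_i f = (𝟙[x_i] − p_i)·D_i f` and `E[(𝟙[x_i] − p_i)²] = p_i(1−p_i)`.  For a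
0/1-valued monotone `f` the last expectation is `P(i pivotal)`, so `Inf_i = p_i(1−p_i)·P(i pivotal)`.
[cite: ODonnell2014, §8.4 Def 8.44 / Prop 8.45 (Inf_i[f] = σ² Pr[f(x) ≠ f(x^{⊕i})])] [cite: GarbanSteif2014, Ch. I Def I.4 (influence = probability of being pivotal)] -/
theorem influence_eq_bias_mul_sum_sq (p : ι → ℝ) (f : (ι → Bool) → ℝ) (i : ι) :
    ∑ x : ι → Bool, wt p x * (f x - ∑ y : ι → Bool, wt p y * f (update x i (y i))) ^ 2
      = p i * (1 - p i) * ∑ x : ι → Bool, wt p x * (f (update x i true) - f (update x i false)) ^ 2 := by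
  -- pointwise: `f x − E_i f x = (x_i ? (1 − p_i) : −p_i)·D(x)` with `D` not reading `x_i`
  have hpt : ∀ x : ι → Bool, wt p x * (f x - ∑ y : ι → Bool, wt p y * f (update x i (y i))) ^ 2
      = wt p x * (if x i = true then (1 - p i) ^ 2 * (f (update x i true) - f (update x i false)) ^ 2
          else (p i) ^ 2 * (f (update x i true) - f (update x i false)) ^ 2) := by
    intro x
    rw [sum_wt_update_eq p f i x]
    rcases Bool.eq_false_or_eq_true (x i) with hx | hx
    · have hu : f x = f (update x i true) := by
        conv_lhs => rw [← update_eq_self i x]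
        rw [hx]
      rw [if_pos hx, hu]; ring
    · have hu : f x = f (update x i false) := by
        conv_lhs => rw [← update_eq_self i x]
        rw [hx]
      simp only [hx, Bool.false_eq_true, if_false]
      rw [hu]; ring
  rw [Finset.sum_congr rfl (fun x _ => hpt x),
    sum_wt_ite p i _ _ (fun x c => by simp only [update_idem]) (fun x c => by simp only [update_idem])]
  have hpull : ∀ c : ℝ, ∑ x : ι → Bool, wt p x * (c * (f (update x i true) - f (update x i false)) ^ 2)
      = c * ∑ x : ι → Bool, wt p x * (f (update x i true) - f (update x i false)) ^ 2 := by
    intro c; rw [Finset.mul_sum]; exact Finset.sum_congr rfl fun x _ => by ring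
  rw [hpull, hpull]
  ring

/-! ## §3 Total influence = mean size of the spectral sample; Markov above level `M` -/

include hH1 hH2 in
/-- **TOTAL INFLUENCE = MEAN SIZE OF THE SPECTRAL SAMPLE**: `Σ_i E[(f − E_i f)²] = Σ_S |S|·f̂(S)²` — each weight `f̂(S)²` is counted once for
every `i ∈ S` (O'Donnell Thm 2.38 / Prop 8.23; in Garban–Steif's language `E_{𝒬_f}[|𝒮_f|] = I(f)` for the spectral measure `𝒬_f(S) = f̂(S)²`).
[cite: ODonnell2014, §2.3 Thm 2.38 and §8.3 Prop 8.23 (I[f] = Σ_S |S| f̂(S)²)] [cite: GarbanSteif2014, Ch. IX Def IX.1–IX.2 (spectral measure and sample)] -/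
theorem sum_influence_eq_sum_card_mul_coeff_sq (f : (ι → Bool) → ℝ) :
    ∑ i, ∑ x : ι → Bool, wt p x * (f x - ∑ y : ι → Bool, wt p y * f (update x i (y i))) ^ 2
      = ∑ S ∈ (Finset.univ : Finset ι).powerset, (S.card : ℝ) * (∑ x : ι → Bool, wt p x * (f x * ∏ j ∈ S, r j (x j))) ^ 2 := by
  obtain ⟨c, hc⟩ : ∃ c : Finset ι → ℝ, c = fun S => (∑ x : ι → Bool, wt p x * (f x * ∏ j ∈ S, r j (x j))) ^ 2 := ⟨_, rfl⟩
  have hi : ∀ i, ∑ x : ι → Bool, wt p x * (f x - ∑ y : ι → Bool, wt p y * f (update x i (y i))) ^ 2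
      = ∑ S ∈ (Finset.univ : Finset ι).powerset, (if i ∈ S then c S else 0) := by
    intro i
    rw [influence_eq_sum_coeff_sq hH1 hH2 f i, Finset.sum_filter, hc]
  rw [Finset.sum_congr rfl (fun i _ => hi i), Finset.sum_comm]
  refine Finset.sum_congr rfl fun S _ => ?_
  rw [Finset.sum_ite_mem, Finset.univ_inter, Finset.sum_const, nsmul_eq_mul, hc]

include hH1 hH2 in
/-- The same identity in the pivotal currency: **`Σ_i p_i(1−p_i)·E[(f(x^{i→1}) − f(x^{i→0}))²] = Σ_S |S|·f̂(S)²`** (for a 0/1-valued monotone `f`: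
`Σ_i p_i(1−p_i)·P(i pivotal)` — on the lattice `p(1−p)·E[N_piv]` — is the mean size of the spectral sample).
[cite: ODonnell2014, §8.4 Prop 8.45 (I[f] = σ² E[sens_f])] [cite: GarbanPeteSchramm2010, §1 (E|𝒮| = E|𝒫| for percolation crossings)] -/
theorem sum_bias_mul_sum_sq_eq_sum_card_mul_coeff_sq (f : (ι → Bool) → ℝ) :
    ∑ i, p i * (1 - p i) * ∑ x : ι → Bool, wt p x * (f (update x i true) - f (update x i false)) ^ 2
      = ∑ S ∈ (Finset.univ : Finset ι).powerset, (S.card : ℝ) * (∑ x : ι → Bool, wt p x * (f x * ∏ j ∈ S, r j (x j))) ^ 2 := by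
  rw [← sum_influence_eq_sum_card_mul_coeff_sq hH1 hH2 f]
  exact Finset.sum_congr rfl fun i _ => (influence_eq_bias_mul_sum_sq p f i).symm

omit [DecidableEq ι] in
/-- **MARKOV ON THE SPECTRAL SAMPLE**: `M·Σ_{|S| ≥ M} f̂(S)² ≤ Σ_S |S|·f̂(S)²` — the Fourier weight above level `M` is at most the total
influence over `M` (the spectrum is `I/M`-concentrated on the levels `< M`).  Stated for any nonnegative weights `c_S`.
[cite: ODonnell2014, §3.1 Prop 3.2 (ε-concentration up to degree I[f]/ε: Markov on |𝒮|)] -/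
theorem mul_high_level_weight_le (c : Finset ι → ℝ) (hc : ∀ S, 0 ≤ c S) (M : ℕ) :
    (M : ℝ) * ∑ S ∈ (Finset.univ : Finset ι).powerset.filter (fun S => M ≤ S.card), c S
      ≤ ∑ S ∈ (Finset.univ : Finset ι).powerset, (S.card : ℝ) * c S := by
  rw [Finset.mul_sum]
  calc ∑ S ∈ (Finset.univ : Finset ι).powerset.filter (fun S => M ≤ S.card), (M : ℝ) * c S
      ≤ ∑ S ∈ (Finset.univ : Finset ι).powerset.filter (fun S => M ≤ S.card), (S.card : ℝ) * c S := by
        refine Finset.sum_le_sum fun S hS => ?_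
        have hM : (M : ℝ) ≤ S.card := by exact_mod_cast (Finset.mem_filter.1 hS).2
        exact mul_le_mul_of_nonneg_right hM (hc S)
    _ ≤ ∑ S ∈ (Finset.univ : Finset ι).powerset, (S.card : ℝ) * c S :=
        Finset.sum_le_sum_of_subset_of_nonneg (Finset.filter_subset _ _)
          (fun S _ _ => mul_nonneg (Nat.cast_nonneg _) (hc S))

end WithH2

end Summit.CriticalPhenomena.PercolationContinuityZ3.Theorems.Crossing.Spectral

end
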